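import Literature.NumberTheory.PAdicHodge.PadicFieldSpectralNorm
import HarnessLib

/-!
# `log_p` of a valuation-side `p`-adic field in its OWN topology: the logarithm series converges in `F` and in `ℂ_F`,
# and `log_p` is a homomorphism on `𝒪_Fˣ` killing the roots of unity

Topic `Literature/NumberTheory/PAdicHodge`; THEOREMS ONLY (no definition, no named fact, no instance, no `sorry`). Sequel of
`PadicFieldSpectralNorm` (the `ℚ_p`-normalised absolute value `PadicField.normedField F p hp`, whose topology IS the given topology of `F`,
`PadicField.topologicalSpace_eq`; `log_p := IUT.LogVolume.unitLog` for it). This file reads the abc-iut cell's `log_p` API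
(`IUT/LogVolume/LocalUnitLog`) in the VALUATION currency of `GaloisRepresentations/*` / `PAdicHodge/*` — no normed structure appears in the
statements except through `unitLog` itself:

* `PadicField.isPrincipal_iff_valuation_lt_one` — `‖1 − u‖ < 1 ↔ valuation F (1 − u) < 1` (principal units);
* ★ `PadicField.hasSum_unitLog` — for a principal unit `u`, **`Σ_{n≥1} −(1−u)ⁿ/n` converges to `log_p u` in the GIVEN topology of `F`**
  (IUT `hasSum_unitLog` transported along `topologicalSpace_eq`), `PadicField.tendsto_logPartialSum`;
* ★ `PadicField.hasSum_algebraMap_unitLog_completedAlgClosure` — the same series, mapped to `ℂ_F = CompletedAlgClosure F`, converges to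
  `algebraMap F ℂ_F (log_p u)` (`F → ℂ_F` is an isometry for the valuation norm, tree `CompletedAlgClosure.isometry_algebraMap`) — the junction
  with Fontaine's `p`-ADIC logarithm in `B_dR⁺/Fil¹ = ℂ_F` (`GaloisContinuity.IsLogModFil`, `θ(log[ũ]) = log_p(ũ♯)`);
* `PadicField.unitLog_mul` / `unitLog_inv` / `unitLog_pow` / `unitLog_eq_zero_of_pow_eq_one` / `unitLog_of_valuation_ne_one` — `log_p` is a
  homomorphism `𝒪_Fˣ → F` killing `μ(F)`, junk `0` off the unit sphere, hypotheses as `valuation F u = 1`.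

Line `kato_lever` of crux K★ `stmt-BirchSwinnertonDyer-22226` ((H5) ↔ (H4)-1d junction); BSD / K★ / [REC] are NOT proved by any of this.

## References
* J. Neukirch, *Algebraic Number Theory* (1999), Ch. II (5.4)–(5.5). [NeukirchANT1999]
* J.-M. Fontaine, *Le corps des périodes p-adiques*, Astérisque 223 (1994), Exp. II §1.5.4. [FontaineAsterisque223III]
-/

noncomputable section

open ValuativeRel Field Filter Topology

namespace Literature.NumberTheory.PAdicHodge

open Literature.NumberTheory.GaloisRepresentations
open Literature.NumberTheory.GaloisRepresentations.IsNonarchimedeanLocalField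
open Literature.IUT.LogVolume

namespace PadicField

variable (F : Type) [Field F] [ValuativeRel F] [TopologicalSpace F] [IsNonarchimedeanLocalField F] [CharZero F]
  (p : ℕ) [hprime : Fact p.Prime] (hp : valuation F p < 1)

/-! ## §1 Principal units and the convergence of the logarithm series in `F` -/

/-- **Principal units**: `‖1 − u‖ < 1` for the `ℚ_p`-normalised norm iff `valuation F (1 − u) < 1`. [cite: NeukirchANT1999, Ch. II (5.3)] -/
theorem isPrincipal_iff_valuation_lt_one (u : F) : (letI := normedField F p hp; IsPrincipal u) ↔ valuation F (1 - u) < 1 := by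
  letI := normedField F p hp
  rw [Literature.IUT.LogVolume.isPrincipal_iff]
  exact norm_lt_one_iff F p hp (1 - u)

/-- ★ **The logarithm series of a principal unit converges to `log_p u` in the given topology of `F`**:
`HasSum (n ↦ −(1−u)^{n+1}/(n+1)) (log_p u)` for `valuation F (1 − u) < 1` (IUT `hasSum_unitLog` for `PadicField.normedField`, whose topology is
the given one). [cite: NeukirchANT1999, Ch. II (5.4)–(5.5)] -/
theorem hasSum_unitLog {u : F} (hu : valuation F (1 - u) < 1) :
    HasSum (fun n : ℕ => -((1 - u) ^ (n + 1)) / (n + 1 : F)) (letI := normedField F p hp; unitLog u) := by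
  have h : @HasSum F ℕ _ (normedField F p hp).toUniformSpace.toTopologicalSpace
      (fun n : ℕ => -((1 - u) ^ (n + 1)) / (n + 1 : F)) (letI := normedField F p hp; unitLog u)
      (SummationFilter.unconditional ℕ) := by
    letI := normedField F p hp
    letI := normedAlgebra F p hp
    haveI := isUltrametricDist F p hp
    haveI := completeSpace F p hp
    exact Literature.IUT.LogVolume.hasSum_unitLog p ((isPrincipal_iff_valuation_lt_one F p hp u).2 hu)
  rwa [topologicalSpace_eq F p hp] at h

/-- The partial sums `Σ_{n<N} −(1−u)^{n+1}/(n+1)` tend to `log_p u` in `F`. [cite: NeukirchANT1999, Ch. II (5.4)–(5.5)] -/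
theorem tendsto_logPartialSum {u : F} (hu : valuation F (1 - u) < 1) :
    Tendsto (fun N : ℕ => ∑ n ∈ Finset.range N, -((1 - u) ^ (n + 1)) / (n + 1 : F)) atTop
      (𝓝 (letI := normedField F p hp; unitLog u)) :=
  (hasSum_unitLog F p hp hu).tendsto_sum_nat

/-- ★ **In `ℂ_F`**: the logarithm series of a principal unit `u ∈ F`, read in `ℂ_F = CompletedAlgClosure F`, converges to
`algebraMap F ℂ_F (log_p u)` (`F → ℂ_F` is an isometry for the valuation norm, hence continuous for the given topology). This is the value
`θ(log[ũ]) = log_p(u)` side of Fontaine's `p`-adic logarithm modulo `Fil¹`. [cite: FontaineAsterisque223III, Exp. II §1.5.4] [cite: NeukirchANT1999, Ch. II (5.5)] -/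
theorem hasSum_algebraMap_unitLog_completedAlgClosure {u : F} (hu : valuation F (1 - u) < 1) :
    HasSum (fun n : ℕ => algebraMap F (CompletedAlgClosure F) (-((1 - u) ^ (n + 1)) / (n + 1 : F)))
      (algebraMap F (CompletedAlgClosure F) (letI := normedField F p hp; unitLog u)) := by
  have hcont : Continuous (algebraMap F (CompletedAlgClosure F)) := by
    letI := nontriviallyNormedField F
    exact (CompletedAlgClosure.isometry_algebraMap (F := F)).continuous
  exact (hasSum_unitLog F p hp hu).map (algebraMap F (CompletedAlgClosure F)) hcont

/-- The same with the terms computed in `ℂ_F`: `HasSum (n ↦ −(1 − ι u)^{n+1}/(n+1)) (ι (log_p u))`, `ι = algebraMap F ℂ_F`.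
[cite: FontaineAsterisque223III, Exp. II §1.5.4] -/
theorem hasSum_unitLog_completedAlgClosure {u : F} (hu : valuation F (1 - u) < 1) :
    HasSum (fun n : ℕ => -((1 - algebraMap F (CompletedAlgClosure F) u) ^ (n + 1)) / (n + 1 : CompletedAlgClosure F))
      (algebraMap F (CompletedAlgClosure F) (letI := normedField F p hp; unitLog u)) := by
  convert hasSum_algebraMap_unitLog_completedAlgClosure F p hp hu using 2 with n
  simp only [map_div₀, map_neg, map_pow, map_sub, map_one, map_add, map_natCast]

/-! ## §2 `log_p` is a homomorphism on `𝒪_Fˣ` (valuation currency) -/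

/-- `log_p(uv) = log_p u + log_p v` for units. [cite: NeukirchANT1999, Ch. II (5.5)] -/
theorem unitLog_mul {u v : F} (hu : valuation F u = 1) (hv : valuation F v = 1) :
    letI := normedField F p hp; unitLog (u * v) = unitLog u + unitLog v := by
  letI := normedField F p hp
  letI := normedAlgebra F p hp
  haveI := isUltrametricDist F p hp
  haveI := completeSpace F p hp
  haveI := properSpace F p hp
  exact Literature.IUT.LogVolume.unitLog_mul p ((norm_eq_one_iff F p hp u).2 hu) ((norm_eq_one_iff F p hp v).2 hv)

/-- `log_p(u⁻¹) = −log_p u` for a unit. [cite: NeukirchANT1999, Ch. II (5.5)] -/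
theorem unitLog_inv {u : F} (hu : valuation F u = 1) : letI := normedField F p hp; unitLog u⁻¹ = -unitLog u := by
  letI := normedField F p hp
  letI := normedAlgebra F p hp
  haveI := isUltrametricDist F p hp
  haveI := completeSpace F p hp
  haveI := properSpace F p hp
  exact Literature.IUT.LogVolume.unitLog_inv p ((norm_eq_one_iff F p hp u).2 hu)

/-- `log_p(uⁿ) = n · log_p u` for a unit. [cite: NeukirchANT1999, Ch. II (5.5)] -/
theorem unitLog_pow {u : F} (hu : valuation F u = 1) (n : ℕ) : letI := normedField F p hp; unitLog (u ^ n) = n * unitLog u := by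
  letI := normedField F p hp
  letI := normedAlgebra F p hp
  haveI := isUltrametricDist F p hp
  haveI := completeSpace F p hp
  haveI := properSpace F p hp
  exact Literature.IUT.LogVolume.unitLog_pow p ((norm_eq_one_iff F p hp u).2 hu) n

/-- `log_p ζ = 0` for a root of unity `ζ`. [cite: NeukirchANT1999, Ch. II (5.5)] -/
theorem unitLog_eq_zero_of_pow_eq_one {ζ : F} {n : ℕ} (hn : 0 < n) (h : ζ ^ n = 1) : letI := normedField F p hp; unitLog ζ = 0 := by
  letI := normedField F p hp
  letI := normedAlgebra F p hp
  haveI := isUltrametricDist F p hp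
  haveI := completeSpace F p hp
  haveI := properSpace F p hp
  exact Literature.IUT.LogVolume.unitLog_eq_zero_of_pow_eq_one p hn h

/-- Junk value: `log_p x = 0` unless `valuation F x = 1`. [cite: NeukirchANT1999, Ch. II (5.5)] -/
theorem unitLog_of_valuation_ne_one {x : F} (hx : valuation F x ≠ 1) : letI := normedField F p hp; unitLog x = 0 := by
  letI := normedField F p hp
  haveI := isUltrametricDist F p hp
  exact Literature.IUT.LogVolume.unitLog_of_norm_ne_one fun h => hx ((norm_eq_one_iff F p hp x).1 h)

end PadicField

end Literature.NumberTheory.PAdicHodge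

end
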